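import Summits.NavierStokesRegularity.FluidComputer.ViscousConjugacyCertificate
import HarnessLib

/-!
# Uniform viscosity is a change of clock, part 3 of 3: the viscosity Tao's gate tolerates
# (`μ < 4/7`: it fires; `μ ≥ 5/7`: it never does) and the viscous cone certificates

Companion of `ViscousConjugacy.lean`, `ViscousConjugacyCertificate.lean` (cell `pub-fluidc`, blueprint seat
bp1; ONE text in three files, same namespace `Summit.NavierStokesRegularity.FluidComputer.ViscousConjugacy`).
PLACEMENT: cell-own derived work, `Summits/NavierStokesRegularity/FluidComputer/` per the 2026-08-19 rule.
HONEST FRAMING (verbatim): *low prior, high value-of-information experiment on Tao's machine paradigm; NOT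
a claim that NS blows up.* The numbers below are properties of the five-mode member (5.5) of
[Tao2016AveragedNS, §5.5] with UNIFORM damping `-μX`, at the constants of Theorem 5.3 as formalised in the
skeleton (`K ≥ 2·20⁴²·42! + 16`, `3000 log K ≤ M ≤ K¹⁰`, `0 < ε ≤ e^{-10M}K^{-100}`); nothing about the
Navier–Stokes equations.

## Contents

* §4' THE PORTRAIT UNDER VISCOSITY (datum (5.6)). `delayFlowVisc_shut`: for `μ ≥ 5/7` the inviscid clock
  `κ_μ < 1/μ ≤ 7/5` never leaves the quiet phase — `|ã(t)| ≤ e^{-μt}·4K⁻¹⁰`, `a(t)² ≥ 0.999·e^{-2μt}` for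
  ALL `t ≥ 0`: the gate never fires, the energy dies on the carrier. `delayFlowVisc_fires`: for `7μ/4 < 1`
  the clock shows `7/4` at viscous time `T_μ(7/4)`, where the state is `(1 - 7μ/4) • Φ_{7/4}(delayInit)`,
  fired: `ã ≥ (1 - 7μ/4)(1 - 4K⁻²⁰)` (energy efficiency `(1 - 7μ/4)²`); `delayFlowVisc_firedOn`: the
  un-shrunk state stays in `firedSet K 6 4` ever after. `viscous_threshold`: both half-lines — **the uniform
  viscosity Tao's gate tolerates is an `O(1)` constant in `(4/7, 5/7]`** (the image `1/t_c` of the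
  transition window `t_c ∈ [7/5, 7/4]`), against the ADVERSARIAL defect tolerance `ε²e^{-M} ≤ 10⁻¹¹` of the
  reach certificates (`seed_le`): viscosity is a benign, not an adversarial, perturbation of this machine.
* §5 THE VISCOUS CONE CERTIFICATES. `taoReachCone_visc`: for `0 < 2μ < c₀`, on the weighted half-plane of
  `taoReachCone_wide`, a reach certificate for `delayCircuitVisc K M ε μ` with `U = univ`, defect
  `(1 - 2μ/c₀)²·ε_d`, cycle time `T_μ(2/c₀)`, from `coneFrom c₀ (closedBall delayInit ρ)` into
  `coneFrom (c₀ - 2μ) (firedSet K 6 4)` — the level drops by exactly `2μ` per cycle. Necessity transported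
  (part 2 `isEmpty_damped_of_curve`): none into `{ã ≠ 0}` once `ε_d ≥ c₀²ε²e^{-M}`
  (`isEmpty_visc_of_sq_mul_seed_le`, every `μ > 0`); none beyond the dud pre-load `1.2535u` while
  `κ_μ(T) ≤ 2/c₀` — automatic for all `T` when `2μ ≥ c₀` — (`isEmpty_visc_of_ge_level`); the
  SHUT-OFF `isEmpty_visc_of_shut`: for `μ ≥ 5c₀/7` no certificate from any class `∋ c₀ • delayInit` into
  `{ã > 4c₀K⁻¹⁰}` at ANY cycle time and ANY defect; in cone currency `isEmpty_taoReachCone_visc_of_shut`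
  (`c₁ > 8c₀K⁻¹⁰`), `isEmpty_taoReachCone_visc_of_ge` (`c₁ > 12c₀e^{-M}`).
* Dictionary (prose, for the cell's DICTIONARY.md §39 / DIVERGENCE.md D43): a cascade stage running Tao's
  gate at frequency `λ_n` in rescaled time `T_n` with uniform damping `νλ_n²` of its five modes has
  `μ_n = νλ_n²T_n`; it fires iff `μ_n` is subthreshold (certified `< 4/7`, refuted `≥ 5/7`) and hands on the
  fraction `1 - 2μ_n/c₀` of its level per cycle — the formal content, for THIS member and UNIFORM damping
  only, of "the machine must outrun viscosity" [Tao2016AveragedNS, §6]; the spread of the true dissipation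
  rates over a shell is NOT covered.

Sources: [cite: Tao2016AveragedNS, §5.5 Theorem 5.3, (5.5), (5.6); Remark 6.1; §6]. No named facts; 0 sorry.
-/

noncomputable section

namespace Summit.NavierStokesRegularity.FluidComputer

open Real Set Metric Filter Topology
open scoped NNReal Pointwise
open Literature.Analysis.FluidPDE.FluidComputer (ReachCertificate)
open Literature.Analysis.FluidPDE.Tao2016AveragedNS

namespace ViscousConjugacy

variable {K M ε : ℝ}

section Standing

variable (hK : 2 * 20 ^ 42 * (Nat.factorial 42 : ℝ) + 16 ≤ K)
  (hML : 3000 * Real.log K ≤ M) (hMK : M ≤ K ^ 10) (hε : 0 < ε)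
  (hεle : ε ≤ exp (-(10 * M)) / K ^ 100)
include hK hML hMK hε hεle

/-! ## §4'. The portrait of the datum (5.6) under uniform viscosity -/

/-- **SHUT: for `μ ≥ 5/7` the gate never fires.** The inviscid clock stays below `1/μ ≤ 7/5`, inside
the quiet phase: `|ã(t)| ≤ e^{-μt}·4K⁻¹⁰` and `a(t)² ≥ 0.999·e^{-2μt}` for every `t ≥ 0` — no energy is
ever transferred; it decays on the carrier. [cite: Tao2016AveragedNS, §5.5 Theorem 5.3; §6] -/
theorem delayFlowVisc_shut {μ : ℝ} (hμ : 5 / 7 ≤ μ) {t : ℝ} (ht : 0 ≤ t) :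
    |delayFlowVisc K M ε μ t delayInit 4| ≤ exp (-(μ * t)) * (4 / K ^ 10) ∧
      999 / 1000 * exp (-(μ * t)) ^ 2 ≤ delayFlowVisc K M ε μ t delayInit 0 ^ 2 := by
  have hμ0 : 0 < μ := by linarith
  obtain ⟨hQ, -, -⟩ := delayFlowWith_delayInit_portrait hK hML hMK hε hεle
  have hc : viscClock μ t ∈ Icc (0 : ℝ) (7 / 5) := by
    refine ⟨viscClock_nonneg hμ0 ht, ?_⟩
    have h1 := viscClock_lt_inv hμ0 t
    have h2 : 1 / μ ≤ 7 / 5 := by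
      rw [div_le_iff₀ hμ0]
      linarith
    linarith
  obtain ⟨h4, -, -, -, h0'⟩ := hQ _ hc
  have e4 : delayFlowVisc K M ε μ t delayInit 4 =
      exp (-(μ * t)) * delayFlowWith K M ε (viscClock μ t) delayInit 4 := rfl
  have e0 : delayFlowVisc K M ε μ t delayInit 0 =
      exp (-(μ * t)) * delayFlowWith K M ε (viscClock μ t) delayInit 0 := rfl
  refine ⟨?_, ?_⟩
  · rw [e4, abs_mul, abs_of_pos (exp_pos _)]
    exact mul_le_mul_of_nonneg_left h4 (exp_pos _).le
  · rw [e0, mul_pow]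
    have := mul_le_mul_of_nonneg_left h0' (sq_nonneg (exp (-(μ * t))))
    linarith

/-- **FIRES: for `μ < 4/7` the gate fires.** The inviscid clock reaches `7/4` at viscous time
`T_μ(7/4) ≥ 0`, where the state is `(1 - 7μ/4) • Φ_{7/4}(delayInit)` with `Φ_{7/4}(delayInit)` fired
`(4,2)`: the output carries amplitude `ã ≥ (1 - 7μ/4)(1 - 4K⁻²⁰)` (energy fraction `(1 - 7μ/4)²` of what is
left). [cite: Tao2016AveragedNS, §5.5 Theorem 5.3; §6] -/
theorem delayFlowVisc_fires {μ : ℝ} (hμ : 0 < μ) (hμ' : μ * (7 / 4) < 1) :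
    0 ≤ viscTime μ (7 / 4) ∧
    delayFlowVisc K M ε μ (viscTime μ (7 / 4)) delayInit =
      (1 - μ * (7 / 4)) • delayFlowWith K M ε (7 / 4) delayInit ∧
    delayFlowWith K M ε (7 / 4) delayInit ∈ firedSet K 4 2 ∧
    (1 - μ * (7 / 4)) * (1 - 4 / K ^ 20) ≤ delayFlowVisc K M ε μ (viscTime μ (7 / 4)) delayInit 4 := by
  obtain ⟨-, hF1, -⟩ := delayFlowWith_delayInit_portrait hK hML hMK hε hεle
  have hq : 0 < 1 - μ * (7 / 4) := by linarith
  have e := delayFlowVisc_viscTime (K := K) (M := M) (ε := ε) hμ.ne' hμ' delayInit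
  have hf : delayFlowWith K M ε (7 / 4) delayInit ∈ firedSet K 4 2 := hF1 (7 / 4) ⟨le_rfl, by norm_num⟩
  refine ⟨viscTime_nonneg hμ (by norm_num) hμ', e, hf, ?_⟩
  have h4 := (mem_firedSet_iff.1 hf).1
  rw [e, Pi.smul_apply, smul_eq_mul]
  have h5 : 1 - 4 / K ^ 20 ≤ delayFlowWith K M ε (7 / 4) delayInit 4 := by
    have := (abs_le.1 h4).1
    linarith
  exact mul_le_mul_of_nonneg_left h5 hq.le

/-- … and from `T_μ(7/4)` on the undamped state `e^{μt} • X(t) = Φ_{κ_μ t}(delayInit)` stays in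
`firedSet K 6 4` forever (`κ_μ t ≥ 7/4`). [cite: Tao2016AveragedNS, §5.5 Theorem 5.3] -/
theorem delayFlowVisc_firedOn {μ : ℝ} (hμ : 0 < μ) (hμ' : μ * (7 / 4) < 1) :
    FiredOn K (fun t => exp (μ * t) • delayFlowVisc K M ε μ t delayInit)
      (Ici (viscTime μ (7 / 4))) 6 4 := by
  obtain ⟨-, hF1, hF2⟩ := delayFlowWith_delayInit_portrait hK hML hMK hε hεle
  obtain ⟨hK16, -⟩ := negKick_params hK hML hMK hε hεle
  have hK0 : 0 < K := by linarith
  rw [firedOn_iff_mem_firedSet]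
  intro t ht
  rw [exp_smul_delayFlowVisc]
  have hc : 7 / 4 ≤ viscClock μ t := by
    have h := (viscClock_le_viscClock_iff hμ).2 (show viscTime μ (7 / 4) ≤ t from ht)
    rwa [viscClock_viscTime hμ.ne' hμ'] at h
  rcases le_or_gt (viscClock μ t) 2 with h2 | h2
  · have h := hF1 _ ⟨hc, h2⟩
    refine ⟨h.1.trans (div_le_div_of_nonneg_right (by norm_num) (by positivity)),
      fun i hi => (h.2 i hi).trans (div_le_div_of_nonneg_right (by norm_num) (by positivity))⟩
  · exact hF2 _ h2.le

/-- At inviscid time `2` (viscous time `T_μ(2)`, `2μ < 1`) the state is the `(1 - 2μ)`-shrinking of a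
point of `firedSet K 6 4`. [cite: Tao2016AveragedNS, §5.5 Theorem 5.3] -/
theorem delayFlowVisc_viscTime_two {μ : ℝ} (hμ : 0 < μ) (hμ' : μ * 2 < 1) :
    delayFlowVisc K M ε μ (viscTime μ 2) delayInit ∈ (1 - μ * 2) • firedSet K 6 4 := by
  obtain ⟨-, -, hF2⟩ := delayFlowWith_delayInit_portrait hK hML hMK hε hεle
  rw [delayFlowVisc_viscTime hμ.ne' hμ']
  exact Set.smul_mem_smul_set (hF2 2 le_rfl)

/-- **THE VISCOSITY TAO'S GATE TOLERATES is an `O(1)` constant in `(4/7, 5/7]`.** Under the standing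
hypotheses of Theorem 5.3: for every `0 < μ < 4/7` the uniformly damped member started at the datum (5.6)
fires (`ã(t) ≥ (1 - 7μ/4)(1 - 4K⁻²⁰) > 0` at some `t ≥ 0`); for every `μ ≥ 5/7` it never does
(`|ã(t)| ≤ 4K⁻¹⁰` for all `t ≥ 0`). The bracket is the image `(1/t)` of the transition window
`t_c ∈ [7/5, 7/4]`; compare the ADVERSARIAL defect tolerance `ε²e^{-M} ≤ 10⁻¹¹` (`seed_le`).
[cite: Tao2016AveragedNS, §5.5 Theorem 5.3; §6] -/
theorem viscous_threshold :
    (∀ μ : ℝ, 0 < μ → μ < 4 / 7 → ∃ t : ℝ, 0 ≤ t ∧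
        (1 - μ * (7 / 4)) * (1 - 4 / K ^ 20) ≤ delayFlowVisc K M ε μ t delayInit 4 ∧
        0 < delayFlowVisc K M ε μ t delayInit 4) ∧
    (∀ μ : ℝ, 5 / 7 ≤ μ → ∀ t : ℝ, 0 ≤ t → |delayFlowVisc K M ε μ t delayInit 4| ≤ 4 / K ^ 10) := by
  obtain ⟨hK16, -⟩ := negKick_params hK hML hMK hε hεle
  have hK0 : 0 < K := by linarith
  refine ⟨fun μ hμ hμ' => ?_, fun μ hμ t ht => ?_⟩
  · have h74 : μ * (7 / 4) < 1 := by linarith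
    obtain ⟨ht0, -, -, hle⟩ := delayFlowVisc_fires hK hML hMK hε hεle hμ h74
    refine ⟨_, ht0, hle, lt_of_lt_of_le ?_ hle⟩
    have hK1 : K ≤ K ^ 20 := by
      simpa using pow_le_pow_right₀ (by linarith : (1 : ℝ) ≤ K) (by norm_num : 1 ≤ 20)
    have hK20 : 4 / K ^ 20 < 1 := by
      rw [div_lt_one (by positivity)]
      linarith
    exact mul_pos (by linarith) (by linarith)
  · have h := (delayFlowVisc_shut hK hML hMK hε hεle hμ ht).1
    refine h.trans ?_
    have h1 : exp (-(μ * t)) ≤ 1 := by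
      rw [exp_le_one_iff]
      have := mul_nonneg (by linarith : (0 : ℝ) ≤ μ) ht
      linarith
    have h4 : 0 ≤ 4 / K ^ 10 := by positivity
    nlinarith

/-- The adversarial defect tolerance of the reach certificates, `ε²e^{-M}`, is at most `10⁻¹¹` under the
standing hypotheses — eleven orders of magnitude below the viscous threshold `4/7`.
[cite: Tao2016AveragedNS, §5.5 Theorem 5.3] -/
theorem seed_le : ε ^ 2 * exp (-M) ≤ 1 / 10 ^ 11 := by
  obtain ⟨-, -, hε2, hexpM, -⟩ := Ignition.ignition_params hK hML hMK hε hεle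
  have h := mul_le_mul hε2 hexpM (exp_pos _).le (by norm_num)
  linarith

/-! ## §5. The viscous cone certificates and the three closed half-lines -/

/-- **TAO'S GATE CERTIFIED UNDER UNIFORM VISCOSITY `0 < 2μ < c₀`.** On the weighted half-plane
`ρ + 1.27(ε_d/c₀²)/√M < 1.2532 ε²e^{-M}/√M` of `taoReachCone_wide`: a reach certificate for the damped member
`delayCircuitVisc K M ε μ`, working region `univ`, defect `(1 - 2μ/c₀)²·ε_d`, cycle time `T_μ(2/c₀)` (the
viscous time at which the inviscid clock shows the inviscid cycle `2/c₀`), from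
`coneFrom c₀ (closedBall delayInit ρ)` into `coneFrom (c₀ - 2μ) (firedSet K 6 4)`: **the level drops by
exactly `2μ` per cycle**, the tolerated defect by the factor `(1 - 2μ/c₀)²`. (`certificateDamp` applied to
`taoReachCone_wide`; `dampOut (1 - 2μ/c₀) (coneFrom c₀ ·) ⊆ coneFrom (c₀ - 2μ) ·`.)
[cite: Tao2016AveragedNS, §5.5 Theorem 5.3, Remark 6.1; §6] -/
def taoReachCone_visc {c₀ ρ εd μ : ℝ} (hc₀ : 0 < c₀) (hρ : 0 ≤ ρ) (hεd : 0 ≤ εd)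
    (hW : ρ + 127 / 100 * (εd / c₀ ^ 2) / Real.sqrt M <
      3133 / 2500 * (ε ^ 2 * exp (-M)) / Real.sqrt M) (hμ : 0 < μ) (hμc : 2 * μ < c₀) :
    ReachCertificate (delayCircuitVisc K M ε μ) (univ : Set (Fin 5 → ℝ))
      ((1 - 2 * μ / c₀) ^ 2 * εd) (viscTime μ (2 / c₀))
      (coneFrom c₀ (closedBall delayInit ρ)) (coneFrom (c₀ - 2 * μ) (firedSet K 6 4)) := by
  have hlt : μ * (2 / c₀) < 1 := by
    rw [mul_div_assoc', div_lt_one hc₀]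
    linarith
  refine certificateOutMono (certificateCast (certificateDamp (T := viscTime μ (2 / c₀))
    (delayCircuitWith_smul K M ε) (fun _ _ => Set.subset_univ _) hμ
    (certificateCast (taoReachCone_wide hK hML hMK hε hεle hc₀ hρ hεd hW) rfl rfl
      (viscClock_viscTime hμ.ne' hlt).symm rfl rfl)) rfl ?_ rfl rfl rfl) ?_
  · rw [exp_neg_mul_viscTime hμ.ne' hlt]
    ring
  · rw [exp_neg_mul_viscTime hμ.ne' hlt]
    intro x hx
    obtain ⟨θ, hθI, q, ⟨c, hc, a, ha, rfl⟩, rfl⟩ := hx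
    refine ⟨θ * c, ?_, a, ha, by rw [smul_smul]⟩
    have h1 : (1 - μ * (2 / c₀)) * c₀ = c₀ - 2 * μ := by
      rw [sub_mul, one_mul, mul_assoc, div_mul_cancel₀ _ hc₀.ne']
      ring
    have hθ0 : (0 : ℝ) ≤ 1 - μ * (2 / c₀) := by linarith
    have h2 := mul_le_mul hθI.1 hc hc₀.le (hθ0.trans hθI.1)
    rw [h1] at h2
    exact h2

omit hK hML hMK hε hεle in
/-- **No viscous certificate into `{ã ≠ 0}` once `ε_d ≥ c₀²·ε²e^{-M}`** (every `μ > 0`, every cycle time,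
every open `U`, every `Ain ∋ c₀ • delayInit`): the rescaled seed-free orbit `s ↦ c₀ • seedFreeOrbit ε (c₀ s)`
is an inviscid adversary with `ã ≡ 0` and all its shrinkings have `ã = 0` (`isEmpty_damped_of_curve`).
[cite: Tao2016AveragedNS, §5.5 Theorem 5.3, Remark 6.1] -/
theorem isEmpty_visc_of_sq_mul_seed_le {c₀ μ : ℝ} (hc₀ : 0 < c₀) (hμ : 0 < μ)
    {U : Set (Fin 5 → ℝ)} (hU : IsOpen U) {εd T : ℝ} (hεd : c₀ ^ 2 * (ε ^ 2 * exp (-M)) ≤ εd)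
    (hT : 0 ≤ T) {Ain Aout : Set (Fin 5 → ℝ)} (hAin : c₀ • delayInit ∈ Ain)
    (hAout : ∀ p ∈ Aout, p 4 ≠ 0) :
    IsEmpty (ReachCertificate (delayCircuitVisc K M ε μ) U εd T Ain Aout) := by
  have hcs : Continuous (seedFreeOrbit ε) :=
    continuous_iff_continuousAt.2 fun t => (hasDerivAt_seedFreeOrbit ε t).continuousAt
  refine isEmpty_damped_of_curve (delayCircuitWith_smul K M ε) hμ hU hT le_rfl hAin
    (x := fun s => c₀ • seedFreeOrbit ε (c₀ * s)) (by simp [seedFreeOrbit_zero])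
    ((hcs.comp (continuous_const_mul c₀)).const_smul c₀).continuousOn (fun s _ => ?_)
    (fun s _ θ _ _ h => ?_)
  · have hD := (hasDerivAt_seedFreeOrbit ε (c₀ * s)).hasDerivWithinAt (s := Ici (c₀ * s))
    have h1 := hasDerivWithinAt_comp_mul hc₀ hD
    refine ⟨_, h1.const_smul c₀, ?_⟩
    show ‖c₀ • (c₀ • _) - delayCircuitWith K M ε (c₀ • seedFreeOrbit ε (c₀ * s))‖ ≤ εd
    rw [delayCircuitWith_smul, smul_smul, ← pow_two, ← smul_sub, norm_smul, Real.norm_eq_abs,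
      abs_of_nonneg (sq_nonneg c₀)]
    exact (mul_le_mul_of_nonneg_left (norm_seedFreeOrbit_defectWith_le K M ε (c₀ * s))
      (sq_nonneg c₀)).trans hεd
  · exact hAout _ h (by simp)

/-- **No viscous certificate beyond the dud pre-load, at any level `c₀ > 0`** (every `μ > 0`): for every
open `U`, `ε_d ≥ 0`, cycle time `T ≥ 0` with `κ_μ(T) ≤ 2/c₀`, input class containing `c₀ • q` for every
`q ∈ closedBall delayInit ρ` with `ρ ≥ 1.2535·ε²e^{-M}/√M`, and output class `⊆ {ã > 6c₀e^{-M}}`, the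
interface is EMPTY: the rescaled negative-kick dud `s ↦ c₀ • Φ_{c₀ s}(kickInit(-κ))` is an exact inviscid
adversary with `|ã| ≤ 6c₀e^{-M}` up to inviscid time `2/c₀`, and so are its shrinkings. (When `2μ ≥ c₀`
the hypothesis `κ_μ(T) ≤ 2/c₀` holds for EVERY `T`, since `κ_μ < 1/μ ≤ 2/c₀`: `viscClock_lt_inv`.)
[cite: Tao2016AveragedNS, §5.5 Theorem 5.3, Remark 6.1] -/
theorem isEmpty_visc_of_ge_level {c₀ μ : ℝ} (hc₀ : 0 < c₀) (hμ : 0 < μ) {U : Set (Fin 5 → ℝ)}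
    (hU : IsOpen U) {εd T ρ : ℝ} (hεd : 0 ≤ εd) (hT0 : 0 ≤ T) (hT : viscClock μ T ≤ 2 / c₀)
    {Ain Aout : Set (Fin 5 → ℝ)} (hAin : ∀ q ∈ closedBall delayInit ρ, c₀ • q ∈ Ain)
    (hρ : 2507 / 2000 * (ε ^ 2 * exp (-M)) / Real.sqrt M ≤ ρ)
    (hAout : ∀ p ∈ Aout, 6 * c₀ * exp (-M) < p 4) :
    IsEmpty (ReachCertificate (delayCircuitVisc K M ε μ) U εd T Ain Aout) := by
  obtain ⟨-, hM4, -, -, -, -⟩ := negKick_params hK hML hMK hε hεle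
  obtain ⟨-, h2⟩ := dud_level_le hK hML hMK hε hεle
  obtain ⟨κ, hκ1, hκ2, -, hdud⟩ := exists_negativeKick_dud_pinned hK hML hMK hε hεle
  have hsq0 : 0 < Real.sqrt M := Real.sqrt_pos.2 (by linarith)
  have hL0 : 0 < 3133 / 2500 * (ε ^ 2 * exp (-M)) / Real.sqrt M := by positivity
  have hκ0 : 0 < κ := hL0.trans hκ1
  have hκle : κ ≤ 1 := by linarith
  have hq : kickInit (-κ) ∈ closedBall delayInit ρ := by
    rw [mem_closedBall, dist_eq_norm]
    exact (norm_kickInit_neg_sub_delayInit hκ0.le hκle).trans (hκ2.le.trans hρ)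
  set z : ℝ → Fin 5 → ℝ := fun t => delayFlowWith K M ε t (kickInit (-κ)) with hzdef
  have hder : ∀ t, HasDerivAt z (delayCircuitWith K M ε (z t)) t := fun t =>
    hasDerivAt_delayFlowWith K M ε _ t
  have hcz : Continuous z := continuous_iff_continuousAt.2 fun t => (hder t).continuousAt
  refine isEmpty_damped_of_curve (delayCircuitWith_smul K M ε) hμ hU hT0 hT (hAin _ hq)
    (x := fun s => c₀ • z (c₀ * s)) (by simp [hzdef, delayFlowWith_zero])
    ((hcz.comp (continuous_const_mul c₀)).const_smul c₀).continuousOn (fun s _ => ?_)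
    (fun s hs θ hθ0 hθ1 h => ?_)
  · exact ⟨_, (hasDerivAt_smul_comp_mul (delayCircuitWith_smul K M ε) (hder (c₀ * s))).hasDerivWithinAt,
      by simp [hεd]⟩
  · have h1 := hAout _ h
    simp only [Pi.smul_apply, smul_eq_mul] at h1
    have hcσ : c₀ * s ∈ Icc (0 : ℝ) 2 := by
      refine ⟨mul_nonneg hc₀.le hs.1, ?_⟩
      have := mul_le_mul_of_nonneg_left hs.2 hc₀.le
      rwa [mul_div_cancel₀ _ hc₀.ne'] at this
    have h3 := (abs_le.1 (hdud (c₀ * s) hcσ).2.2.2).2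
    nlinarith [mul_nonneg (mul_nonneg hc₀.le hθ0.le) (sub_nonneg.2 h3),
      mul_nonneg (mul_nonneg hc₀.le (sub_nonneg.2 hθ1)) (exp_pos (-M)).le, h1]

/-- **SHUT-OFF: for `μ ≥ 5c₀/7` no viscous certificate at all** — from ANY input class containing
`c₀ • delayInit`, into ANY output class `⊆ {ã > 4c₀K⁻¹⁰}`, at ANY cycle time `T ≥ 0` and ANY defect
`ε_d ≥ 0`, over any open `U`: the level-`c₀` inviscid flow `s ↦ c₀ • Φ_{c₀ s}(delayInit)` is quiet
(`|ã| ≤ 4c₀K⁻¹⁰`) up to inviscid time `7/(5c₀) ≥ 1/μ > κ_μ(T)`, i.e. for the whole viscous eternity.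
[cite: Tao2016AveragedNS, §5.5 Theorem 5.3, Remark 6.1; §6] -/
theorem isEmpty_visc_of_shut {c₀ μ : ℝ} (hc₀ : 0 < c₀) (hμ : 5 / 7 * c₀ ≤ μ) {U : Set (Fin 5 → ℝ)}
    (hU : IsOpen U) {εd T : ℝ} (hεd : 0 ≤ εd) (hT0 : 0 ≤ T) {Ain Aout : Set (Fin 5 → ℝ)}
    (hAin : c₀ • delayInit ∈ Ain) (hAout : ∀ p ∈ Aout, 4 * c₀ / K ^ 10 < p 4) :
    IsEmpty (ReachCertificate (delayCircuitVisc K M ε μ) U εd T Ain Aout) := by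
  have hμ0 : 0 < μ := lt_of_lt_of_le (by positivity) hμ
  obtain ⟨hK16, -⟩ := negKick_params hK hML hMK hε hεle
  have hK0 : 0 < K := by linarith
  obtain ⟨hQ, -, -⟩ := delayFlowWith_delayInit_portrait hK hML hMK hε hεle
  set z : ℝ → Fin 5 → ℝ := fun t => delayFlowWith K M ε t delayInit with hzdef
  have hder : ∀ t, HasDerivAt z (delayCircuitWith K M ε (z t)) t := fun t =>
    hasDerivAt_delayFlowWith K M ε _ t
  have hcz : Continuous z := continuous_iff_continuousAt.2 fun t => (hder t).continuousAt
  refine isEmpty_damped_of_curve (delayCircuitWith_smul K M ε) hμ0 hU hT0 le_rfl hAin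
    (x := fun s => c₀ • z (c₀ * s)) (by simp [hzdef, delayFlowWith_zero])
    ((hcz.comp (continuous_const_mul c₀)).const_smul c₀).continuousOn (fun s _ => ?_)
    (fun s hs θ hθ0 hθ1 h => ?_)
  · exact ⟨_, (hasDerivAt_smul_comp_mul (delayCircuitWith_smul K M ε) (hder (c₀ * s))).hasDerivWithinAt,
      by simp [hεd]⟩
  · have h1 := hAout _ h
    simp only [Pi.smul_apply, smul_eq_mul] at h1
    have hcs : c₀ * s ∈ Icc (0 : ℝ) (7 / 5) := by
      refine ⟨mul_nonneg hc₀.le hs.1, ?_⟩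
      have h2 : s < 1 / μ := lt_of_le_of_lt hs.2 (viscClock_lt_inv hμ0 T)
      have h3 : c₀ * s ≤ c₀ * (1 / μ) := mul_le_mul_of_nonneg_left h2.le hc₀.le
      have h4 : c₀ * (1 / μ) ≤ 7 / 5 := by
        rw [mul_one_div, div_le_iff₀ hμ0]
        linarith
      linarith
    have h4 := (abs_le.1 (hQ _ hcs).1).2
    have h6 : θ * (c₀ * z (c₀ * s) 4) ≤ 4 * c₀ / K ^ 10 := by
      have h7 : c₀ * z (c₀ * s) 4 ≤ c₀ * (4 / K ^ 10) := mul_le_mul_of_nonneg_left h4 hc₀.le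
      have h8 : θ * (c₀ * z (c₀ * s) 4) ≤ θ * (c₀ * (4 / K ^ 10)) :=
        mul_le_mul_of_nonneg_left h7 hθ0.le
      have h9 : θ * (c₀ * (4 / K ^ 10)) ≤ 1 * (c₀ * (4 / K ^ 10)) :=
        mul_le_mul_of_nonneg_right hθ1 (by positivity)
      have h10 : (1 : ℝ) * (c₀ * (4 / K ^ 10)) = 4 * c₀ / K ^ 10 := by ring
      linarith
    linarith

/-- … in cone currency: for `μ ≥ 5c₀/7` NO certificate for the damped member with `U = univ` from
`coneFrom c₀ (closedBall delayInit ρ)` (`ρ ≥ 0`) into `coneFrom c₁ (firedSet K 6 4)`, for ANY level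
`c₁ > 8c₀K⁻¹⁰`, ANY cycle time and ANY defect — while `taoReachCone_visc` certifies into level `c₁ = c₀ - 2μ`
for every `μ < c₀/2` on the half-plane. The viscous axis of Tao's gate is closed from above at an `O(1)`
multiple of the level, open below another. [cite: Tao2016AveragedNS, §5.5 Theorem 5.3, Remark 6.1; §6] -/
theorem isEmpty_taoReachCone_visc_of_shut {c₀ c₁ μ ρ εd T : ℝ} (hc₀ : 0 < c₀) (hμ : 5 / 7 * c₀ ≤ μ)
    (hρ : 0 ≤ ρ) (hεd : 0 ≤ εd) (hT0 : 0 ≤ T) (hc₁ : 8 * c₀ / K ^ 10 < c₁) :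
    IsEmpty (ReachCertificate (delayCircuitVisc K M ε μ) (univ : Set (Fin 5 → ℝ)) εd T
      (coneFrom c₀ (closedBall delayInit ρ)) (coneFrom c₁ (firedSet K 6 4))) := by
  obtain ⟨hK16, -⟩ := negKick_params hK hML hMK hε hεle
  have hK0 : 0 < K := by linarith
  have hK20 : (6 : ℝ) ≤ K ^ 20 / 2 := by
    have : (16 : ℝ) ≤ K ^ 20 := by
      calc (16 : ℝ) ≤ K := hK16
        _ = K ^ 1 := (pow_one K).symm
        _ ≤ K ^ 20 := pow_le_pow_right₀ (by linarith) (by norm_num)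
    linarith
  have hc₁0 : 0 ≤ c₁ := (lt_of_le_of_lt (by positivity) hc₁).le
  refine isEmpty_visc_of_shut hK hML hMK hε hεle hc₀ hμ isOpen_univ hεd hT0
    (smul_mem_coneFrom le_rfl (mem_closedBall_self hρ)) fun p hp => ?_
  have h := half_le_four_of_mem_coneFrom_firedSet hK0 hK20 hc₁0 hp
  have e : 8 * c₀ / K ^ 10 = 2 * (4 * c₀ / K ^ 10) := by ring
  linarith

/-- … and beyond the dud pre-load `1.2535u` NO certificate into `coneFrom c₁ (firedSet K 6 4)` for any
`c₁ > 12c₀e^{-M}` while `κ_μ(T) ≤ 2/c₀` (every `μ > 0`; every `T` once `2μ ≥ c₀`).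
[cite: Tao2016AveragedNS, §5.5 Theorem 5.3, Remark 6.1] -/
theorem isEmpty_taoReachCone_visc_of_ge {c₀ c₁ μ εd ρ T : ℝ} (hc₀ : 0 < c₀) (hμ : 0 < μ)
    (hεd : 0 ≤ εd) (hT0 : 0 ≤ T) (hT : viscClock μ T ≤ 2 / c₀)
    (hρ : 2507 / 2000 * (ε ^ 2 * exp (-M)) / Real.sqrt M ≤ ρ) (hc₁ : 12 * c₀ * exp (-M) < c₁) :
    IsEmpty (ReachCertificate (delayCircuitVisc K M ε μ) (univ : Set (Fin 5 → ℝ)) εd T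
      (coneFrom c₀ (closedBall delayInit ρ)) (coneFrom c₁ (firedSet K 6 4))) := by
  obtain ⟨hK16, -⟩ := negKick_params hK hML hMK hε hεle
  have hK0 : 0 < K := by linarith
  have hK20 : (6 : ℝ) ≤ K ^ 20 / 2 := by
    have : (16 : ℝ) ≤ K ^ 20 := by
      calc (16 : ℝ) ≤ K := hK16
        _ = K ^ 1 := (pow_one K).symm
        _ ≤ K ^ 20 := pow_le_pow_right₀ (by linarith) (by norm_num)
    linarith
  have hc₁0 : 0 ≤ c₁ := (lt_of_le_of_lt (by positivity) hc₁).le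
  refine isEmpty_visc_of_ge_level hK hML hMK hε hεle hc₀ hμ isOpen_univ hεd hT0 hT
    (fun q hq => smul_mem_coneFrom le_rfl hq) hρ fun p hp => ?_
  have h := half_le_four_of_mem_coneFrom_firedSet hK0 hK20 hc₁0 hp
  linarith

end Standing

end ViscousConjugacy

end Summit.NavierStokesRegularity.FluidComputer
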